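import Summits.CriticalPhenomena.CardyFormulaZ2.Theorems.CardyBoundaryCoulombGasHalfPlaneMarkDensityLawSubseqRigidity
import Summits.CriticalPhenomena.CardyFormulaZ2.Theorems.CardyBoundaryCoulombGasHalfPlaneMarkDensityLawNecessity
import Summits.CriticalPhenomena.CardyFormulaZ2.Theses.CardyMirrorMonotone
import Summits.CriticalPhenomena.CardyFormulaZ2.Theses.CardyBlackNoise
import Summits.CriticalPhenomena.CardyFormulaZ2.Theses.CardyExpCovariance

/-!
# Line `Sketch` — corollaries of subsequential rigidity: crux 5 versus the subsequential
# identification cruxes and the X_M targets (crux `HalfPlaneMarkDensityLaw`, stmt-CriticalPhenomena-5661)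

From `eqOn_cardyFunction_of_collinearCardy_subseq` (file `…SubseqRigidity`: under C⁺ — `⟺` crux 5 —
every function `g` that is the limit, along SOME mesh sequence `u_k → 0⁺`, of the crossing probabilities
of all conformal rectangles as a function of the cross-ratio equals Cardy's `F` on `(0,1)`), BY NAME:

* crux 5 IMPLIES the three subsequential identification cruxes
  `CardyMirrorMonotone.SubseqRigidity` (stmt-CriticalPhenomena-8271, rated XL),
  `CardyBlackNoise.SubseqCardyRigidity` (stmt-CriticalPhenomena-8850) and
  `CardyExpCovariance.CardyRigiditySeq` (stmt-CriticalPhenomena-4680) — no SLE₆ identification is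
  needed once a half-plane Cardy statement is available; the conjunct implies them too (necessity);
* `cardyFormulaZ2_iff_halfPlaneMarkDensityLaw_and_subseqConformalInvariance :
  CardyFormulaZ2 ↔ HalfPlaneMarkDensityLaw ∧ CardyMirrorMonotone.SubseqConformalInvariance` — Cardy's
  formula on `ℤ²` is EXACTLY "value" (crux 5: the half-plane mark density law) plus "conformal
  invariance of subsequential limits" (X_M, stmt-CriticalPhenomena-8266: every mesh sequence has a
  subsequence along which all conformal rectangles converge to one function of the cross-ratio; no
  uniqueness, no value); the same with the X_M copies of CardyBlackNoise (stmt-8846) and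
  CardyExpCovariance (stmt-4678).
-/

noncomputable section

namespace Summit.CriticalPhenomena.CardyFormulaZ2.Cruxes.HalfPlaneMarkDensityLaw.SketchLine

open Set MeasureTheory Filter
open Literature.Probability.LatticeModels
open Literature.Probability.Percolation hiding cardyFunction
open Literature.Probability.RandomPlanarGeometry
open Summit.CriticalPhenomena.CardyFormulaZ2.Theorems.HalfPlaneMarkDensityLaw.Negative
open Summit.CriticalPhenomena.CardyFormulaZ2.Theses.CardyBoundaryCoulombGas (HalfPlaneMarkDensityLaw)
open Summit.CriticalPhenomena.CardyFormulaZ2.Theses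
open scoped Topology

/-- **C⁺ ⟹ `SubseqRigidity`** (stmt-CriticalPhenomena-8271, route CardyMirrorMonotone). [folklore] -/
theorem subseqRigidity_of_collinearCardy
    (hC : ∀ a b c y : ℝ, a < b → b < c → c < y →
      Tendsto (fun n : ℕ ↦ μ.real (openCrossing halfPlane (arcA a b n) (rowIcc ⌊c * n⌋ ⌊y * n⌋))) atTop
        (𝓝 (Literature.Probability.RandomPlanarGeometry.cardyFunction
          (Literature.Probability.RandomPlanarGeometry.crossRatio ![a, b, c, y])))) :
    CardyMirrorMonotone.SubseqRigidity :=
  fun u hu g hg ↦ eqOn_cardyFunction_of_collinearCardy_subseq hC u hu g hg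

/-- **Crux 5 ⟹ `SubseqRigidity`** (stmt-5661 ⟹ stmt-8271; registered stub, verbatim signature).
[folklore] -/
theorem subseqRigidity_of_halfPlaneMarkDensityLaw :
    Summit.CriticalPhenomena.CardyFormulaZ2.Theses.CardyBoundaryCoulombGas.HalfPlaneMarkDensityLaw →
      Summit.CriticalPhenomena.CardyFormulaZ2.Theses.CardyMirrorMonotone.SubseqRigidity :=
  fun h ↦ subseqRigidity_of_collinearCardy (stub_converse h)

/-- **Crux 5 ⟹ `SubseqCardyRigidity`** (stmt-5661 ⟹ stmt-8850, route CardyBlackNoise; registered stub).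
[folklore] -/
theorem subseqCardyRigidity_of_halfPlaneMarkDensityLaw :
    Summit.CriticalPhenomena.CardyFormulaZ2.Theses.CardyBoundaryCoulombGas.HalfPlaneMarkDensityLaw →
      Summit.CriticalPhenomena.CardyFormulaZ2.Theses.CardyBlackNoise.SubseqCardyRigidity :=
  fun h δ f hδ hf ↦ eqOn_cardyFunction_of_collinearCardy_subseq (stub_converse h) δ hδ f hf

/-- **Crux 5 ⟹ `CardyRigiditySeq`** (stmt-5661 ⟹ stmt-4680, route CardyExpCovariance; registered
stub). [folklore] -/
theorem cardyRigiditySeq_of_halfPlaneMarkDensityLaw :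
    Summit.CriticalPhenomena.CardyFormulaZ2.Theses.CardyBoundaryCoulombGas.HalfPlaneMarkDensityLaw →
      Summit.CriticalPhenomena.CardyFormulaZ2.Theses.CardyExpCovariance.CardyRigiditySeq :=
  fun h u f hu hf ↦ eqOn_cardyFunction_of_collinearCardy_subseq (stub_converse h) u hu f hf

/-- Necessity: the conjunct implies `SubseqRigidity`. [folklore] -/
theorem subseqRigidity_of_cardyFormulaZ2 : _root_.CardyFormulaZ2 → CardyMirrorMonotone.SubseqRigidity :=
  fun h ↦ subseqRigidity_of_collinearCardy (collinearCardy_of_cardyFormulaZ2 h)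

/-- Necessity: the conjunct implies `SubseqCardyRigidity`. [folklore] -/
theorem subseqCardyRigidity_of_cardyFormulaZ2 :
    _root_.CardyFormulaZ2 → CardyBlackNoise.SubseqCardyRigidity :=
  fun h ↦ subseqCardyRigidity_of_halfPlaneMarkDensityLaw (halfPlaneMarkDensityLaw_of_cardyFormulaZ2 h)

/-- Necessity: the conjunct implies `CardyRigiditySeq`. [folklore] -/
theorem cardyRigiditySeq_of_cardyFormulaZ2 :
    _root_.CardyFormulaZ2 → CardyExpCovariance.CardyRigiditySeq :=
  fun h ↦ cardyRigiditySeq_of_halfPlaneMarkDensityLaw (halfPlaneMarkDensityLaw_of_cardyFormulaZ2 h)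

/-! ## Crux 5 + conformal invariance of subsequential limits (X_M) = the conjunct -/

/-- **C⁺ and X_M give the conjunct** (the deciding-theorem pattern of route CardyMirrorMonotone with its
`SubseqRigidity` hypothesis discharged by C⁺: `𝓝[>] 0` is sequential, every mesh sequence has a
subsequence along which all rectangles converge to some `g ∘ η`, and `g = F` by subsequential
rigidity). [folklore] -/
theorem cardyFormulaZ2_of_collinearCardy_of_subseqConformalInvariance
    (hC : ∀ a b c y : ℝ, a < b → b < c → c < y →
      Tendsto (fun n : ℕ ↦ μ.real (openCrossing halfPlane (arcA a b n) (rowIcc ⌊c * n⌋ ⌊y * n⌋))) atTop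
        (𝓝 (Literature.Probability.RandomPlanarGeometry.cardyFunction
          (Literature.Probability.RandomPlanarGeometry.crossRatio ![a, b, c, y]))))
    (hM : CardyMirrorMonotone.SubseqConformalInvariance) : _root_.CardyFormulaZ2 := by
  intro R ψ x hU
  refine tendsto_of_subseq_tendsto fun ns hns ↦ ?_
  obtain ⟨φ, hφ, g, hg⟩ := hM ns hns
  refine ⟨φ, ?_⟩
  have hEq := subseqRigidity_of_collinearCardy hC (ns ∘ φ) (hns.comp hφ.tendsto_atTop) g
    (fun R' ψ' x' hU' ↦ hg R' ψ' x' hU') (ConformalRectangle.crossRatio_mem_Ioo_of_isUniformizing hU)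
  rw [← hEq]
  exact hg R ψ x hU

/-- **Crux 5 and X_M give the conjunct** (registered stub, verbatim signature):
`HalfPlaneMarkDensityLaw → CardyMirrorMonotone.SubseqConformalInvariance → CardyFormulaZ2`. [folklore] -/
theorem cardyFormulaZ2_of_halfPlaneMarkDensityLaw_of_subseqConformalInvariance :
    Summit.CriticalPhenomena.CardyFormulaZ2.Theses.CardyBoundaryCoulombGas.HalfPlaneMarkDensityLaw →
      Summit.CriticalPhenomena.CardyFormulaZ2.Theses.CardyMirrorMonotone.SubseqConformalInvariance →
        _root_.CardyFormulaZ2 :=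
  fun h hM ↦ cardyFormulaZ2_of_collinearCardy_of_subseqConformalInvariance (stub_converse h) hM

/-- The conjunct gives X_M (with the trivial subsequence and `g = F`). [folklore] -/
theorem subseqConformalInvariance_of_cardyFormulaZ2 :
    _root_.CardyFormulaZ2 → CardyMirrorMonotone.SubseqConformalInvariance :=
  fun h _ hu ↦ ⟨id, strictMono_id, Literature.Probability.RandomPlanarGeometry.cardyFunction,
    fun R ψ x hU ↦ (h R ψ x hU).comp hu⟩

/-- **The logical position of crux 5, sharpest form** (registered stub, verbatim signature):
`CardyFormulaZ2 ↔ HalfPlaneMarkDensityLaw ∧ SubseqConformalInvariance` — Cardy's formula for bond-`ℤ²`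
is exactly the half-plane mark density law (VALUE) plus conformal invariance of subsequential crossing
limits (X_M, stmt-CriticalPhenomena-8266; precompactness-grade existence, no uniqueness, no value).
[folklore] -/
theorem cardyFormulaZ2_iff_halfPlaneMarkDensityLaw_and_subseqConformalInvariance :
    _root_.CardyFormulaZ2 ↔
      Summit.CriticalPhenomena.CardyFormulaZ2.Theses.CardyBoundaryCoulombGas.HalfPlaneMarkDensityLaw ∧
        Summit.CriticalPhenomena.CardyFormulaZ2.Theses.CardyMirrorMonotone.SubseqConformalInvariance :=
  ⟨fun h ↦ ⟨halfPlaneMarkDensityLaw_of_cardyFormulaZ2 h, subseqConformalInvariance_of_cardyFormulaZ2 h⟩,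
    fun h ↦ cardyFormulaZ2_of_halfPlaneMarkDensityLaw_of_subseqConformalInvariance h.1 h.2⟩

/-- The same with the X_M target of route CardyBlackNoise (stmt-CriticalPhenomena-8846):
`HalfPlaneMarkDensityLaw → CardyBlackNoise.SubseqConformalInvariance → CardyFormulaZ2`. [folklore] -/
theorem cardyFormulaZ2_of_halfPlaneMarkDensityLaw_of_subseqConformalInvariance_blackNoise
    (h : HalfPlaneMarkDensityLaw) (hM : CardyBlackNoise.SubseqConformalInvariance) : _root_.CardyFormulaZ2 :=
  cardyFormulaZ2_of_halfPlaneMarkDensityLaw_of_subseqConformalInvariance h fun u hu ↦ by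
    obtain ⟨ψ, f, hψ, hf⟩ := hM u hu
    exact ⟨ψ, hψ, f, hf⟩

/-- The same with the X_M target of route CardyExpCovariance (stmt-CriticalPhenomena-4678):
`HalfPlaneMarkDensityLaw → CardyExpCovariance.SubseqConformalInvariance → CardyFormulaZ2`. [folklore] -/
theorem cardyFormulaZ2_of_halfPlaneMarkDensityLaw_of_subseqConformalInvariance_expCovariance
    (h : HalfPlaneMarkDensityLaw) (hM : CardyExpCovariance.SubseqConformalInvariance) :
    _root_.CardyFormulaZ2 :=
  cardyFormulaZ2_of_halfPlaneMarkDensityLaw_of_subseqConformalInvariance h fun u hu ↦ by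
    obtain ⟨ψ, f, hψ, hf⟩ := hM u hu
    exact ⟨ψ, hψ, f, hf⟩

end Summit.CriticalPhenomena.CardyFormulaZ2.Cruxes.HalfPlaneMarkDensityLaw.SketchLine

end
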